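import Summits.KontsevichZagierPeriods.Zeta5Search.DualSeriesLemma19Order
import Summits.KontsevichZagierPeriods.Zeta5Search.WedgeDictionaryFaceSymmetric
import HarnessLib

/-!
# ζ(5) search — Zudilin's Lemma 19 denominators on the record direction `a = (8,16,10,15,12,16,18,13)·n`
(cell `pub-zeta5`, P1; census-facing corollary)

HONEST FRAMING: systematic search; no irrationality claim unless certified.

OUR work (Summit side, P1 seat generation 4).  Brown–Zudilin's record parameters `a = n·(8,16,10,15,12,16,18,13)`
(`recordVec`, arXiv:2210.03391 Theorem 1) have dual parameters `b(a) = n·(41; 17,16,15,14,13,12,11)` (`bOfA_record`);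
sorting the slots (`U`, `W`, `V` are symmetric in `b₁,…,b₇`: `coeffU_swap`, `coeffW_swap`, `coeffV_swap`) and taking
`σ = 12n` in `DualSeriesLemma19{,Coeffs,Order}` gives the PROVED denominators of [Zudilin2004, §8 Lemma 19] on this
direction (`record_denominators`):

  `D_{17n} · Ñ · U ∈ ℤ`,   `D_{17n}³ · Ñ · W ∈ ℤ`,   `D_{18n} · D_{17n}⁵ · Ñ · V ∈ ℤ`,

`Ñ = (7n)!(9n)!(11n)!(13n)!(15n)!(17n)!` (`normaliser19` of the sorted vector), `D_m = lcm(1,…,m)` (`Nat.lcmUpto`).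
Exponent bookkeeping for the cell's tables (numbers, not adjectives): the common denominator of the linear form
`Ñ·F̃₇ = Ñ(Uζ(5) + Wζ(3) − V)` provided here is `D_{18n}D_{17n}⁵` (exponent sum `103n`, Zudilin's
`m = (18,17,17,17,17,17)·n`), against `d_{41n}⁶` (`246n`) from `DualSeriesDenominators.coeffV_den` and the
CONJECTURAL `84n` of Brown–Zudilin's (28).  All margins of the cell stay negative; this is the honest "proved" line.
-/

noncomputable section

open Finset Polynomial
open Literature.NumberTheory.Transcendental
open Literature.NumberTheory.Transcendental.BallRivoal

namespace Summit.KontsevichZagierPeriods.Zeta5Search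

namespace DualSeriesLemma19

open DualSeries WedgeDictionary PFSteps DualSeriesDenominators
open Literature.NumberTheory.Irrationality.BrownZudilin2022 (bOfA recordVec)

/-! ### `V` is symmetric in the slots -/

/-- `coeffV b` depends on `b 0` and `numPoly b` only. -/
theorem coeffV_congr' {b b' : ℕ → ℤ} (h0 : b 0 = b' 0) (hnum : numPoly b = numPoly b') : coeffV b = coeffV b' := by
  unfold coeffV
  rw [h0, pfData_congr' h0 hnum]

/-- `V` is symmetric in the slots `b₁,…,b₇`. -/
theorem coeffV_swap (b : ℕ → ℤ) {j k : ℕ} (hj : j ∈ Icc 1 7) (hk : k ∈ Icc 1 7) :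
    coeffV (fun i => b (Equiv.swap j k i)) = coeffV b :=
  coeffV_congr' (show b (Equiv.swap j k 0) = b 0 by
    rw [Equiv.swap_apply_of_ne_of_ne (by have := (mem_Icc.1 hj).1; omega) (by have := (mem_Icc.1 hk).1; omega)])
    (numPoly_swap b hj hk)

/-! ### The record direction and its sorted form -/

/-- The dual parameters of the record direction: `b = n·(41; 17,16,15,14,13,12,11)`. -/
def bRecord (n : ℕ) : ℕ → ℤ := fun j =>
  if j = 0 then ((41 * n : ℕ) : ℤ) else if j ≤ 7 then (((18 - j) * n : ℕ) : ℤ) else 0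

/-- The same slots sorted increasingly: `n·(41; 11,12,13,14,15,16,17)`. -/
def bSorted (n : ℕ) : ℕ → ℤ := fun j =>
  if j = 0 then ((41 * n : ℕ) : ℤ) else if j ≤ 7 then (((10 + j) * n : ℕ) : ℤ) else 0

/-- `b(n·a_record) = bRecord n`. -/
theorem bOfA_record (n : ℕ) : bOfA (fun i => (n : ℤ) * recordVec i) = bRecord n := by
  funext j
  rcases j with _ | _ | _ | _ | _ | _ | _ | _ | k <;> simp [bOfA, recordVec, bRecord] <;> ring

/-- `bRecord` is `bSorted` with the slots reversed, `(1 7)(2 6)(3 5)`. -/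
theorem bRecord_eq_perm (n : ℕ) :
    bRecord n = fun i => bSorted n (Equiv.swap 3 5 (Equiv.swap 2 6 (Equiv.swap 1 7 i))) := by
  funext i
  rcases i with _ | _ | _ | _ | _ | _ | _ | _ | k
  all_goals simp [bRecord, bSorted, Equiv.swap_apply_def]
  omega

/-- `U`, `W`, `V` of the record direction are those of the sorted vector. -/
theorem coeff_record_eq (n : ℕ) :
    coeffU (bRecord n) = coeffU (bSorted n) ∧ coeffW (bRecord n) = coeffW (bSorted n) ∧
      coeffV (bRecord n) = coeffV (bSorted n) := by
  have h1 : (1 : ℕ) ∈ Icc 1 7 := by simp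
  have h2 : (2 : ℕ) ∈ Icc 1 7 := by simp
  have h3 : (3 : ℕ) ∈ Icc 1 7 := by simp
  have h5 : (5 : ℕ) ∈ Icc 1 7 := by simp
  have h6 : (6 : ℕ) ∈ Icc 1 7 := by simp
  have h7 : (7 : ℕ) ∈ Icc 1 7 := by simp
  set b₃ : ℕ → ℤ := fun i => bSorted n (Equiv.swap 3 5 i) with hb₃
  set b₂ : ℕ → ℤ := fun i => b₃ (Equiv.swap 2 6 i) with hb₂
  have hrec : bRecord n = fun i => b₂ (Equiv.swap 1 7 i) := by rw [bRecord_eq_perm]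
  rw [hrec]
  exact ⟨((coeffU_swap b₂ h1 h7).trans (coeffU_swap b₃ h2 h6)).trans (coeffU_swap _ h3 h5),
    ((coeffW_swap b₂ h1 h7).trans (coeffW_swap b₃ h2 h6)).trans (coeffW_swap _ h3 h5),
    ((coeffV_swap b₂ h1 h7).trans (coeffV_swap b₃ h2 h6)).trans (coeffV_swap _ h3 h5)⟩

/-- The sorted vector lies in the region of `DualSeriesLemma19` with `σ = 12n`. -/
theorem bSorted_hyps (n : ℕ) :
    InBox (bSorted n) ∧ (∑ j ∈ range 7, bSorted n (j + 1) ≤ 3 * bSorted n 0 + 1) ∧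
      bn (bSorted n) 0 = 41 * n ∧ (∀ j, 1 ≤ j → j ≤ 7 → bn (bSorted n) j = (10 + j) * n) := by
  have hv : ∀ j, 1 ≤ j → j ≤ 7 → bSorted n j = (((10 + j) * n : ℕ) : ℤ) := by
    intro j hj1 hj7; simp [bSorted, show j ≠ 0 by omega, hj7]
  refine ⟨⟨by simp [bSorted], fun j hj => ?_⟩, ?_, by unfold bn bSorted; rw [if_pos rfl, Int.toNat_natCast],
    fun j hj1 hj7 => ?_⟩
  · have hj' := mem_range.1 hj
    rw [hv (j + 1) (by omega) (by omega)]
    simp only [bSorted, if_true]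
    constructor
    · positivity
    · have : (10 + (j + 1)) * n ≤ 41 * n + 1 := by nlinarith
      exact_mod_cast this
  · have e : ∀ j ∈ range 7, bSorted n (j + 1) = (((10 + (j + 1)) * n : ℕ) : ℤ) := fun j hj =>
      hv (j + 1) (by omega) (by have := mem_range.1 hj; omega)
    rw [sum_congr rfl e]
    simp only [sum_range_succ, sum_range_zero, bSorted, if_true, zero_add]
    norm_num
    omega
  · rw [bn, hv j hj1 hj7, Int.toNat_natCast]

/-- **Zudilin's Lemma 19 on the record direction** `b = n·(41;17,…,11)` (sorted, `σ = 12n`):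
`D_{17n}·Ñ·U ∈ ℤ`, `D_{17n}³·Ñ·W ∈ ℤ`, `D_{18n}·D_{17n}⁵·Ñ·V ∈ ℤ` with `Ñ = normaliser19 (bSorted n)`
[Zudilin2004, §8 Lemma 19; exponents `m₀ = 17n`, `m = (18,17,17,17,17,17)·n`]. -/
theorem record_denominators (n : ℕ) :
    (∃ z : ℤ, ((Nat.lcmUpto (17 * n) : ℕ) : ℚ) * (normaliser19 (bSorted n) : ℚ) * coeffU (bRecord n) = z) ∧
    (∃ z : ℤ, ((Nat.lcmUpto (17 * n) : ℕ) : ℚ) ^ 3 * (normaliser19 (bSorted n) : ℚ) * coeffW (bRecord n) = z) ∧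
    (∃ z : ℤ, (((Nat.lcmUpto (18 * n) : ℕ) : ℚ) * ((Nat.lcmUpto (17 * n) : ℕ) : ℚ) ^ 5) *
        (normaliser19 (bSorted n) : ℚ) * coeffV (bRecord n) = z) := by
  obtain ⟨hU, hW, hV⟩ := coeff_record_eq n
  obtain ⟨hb, hsum, h0, hj⟩ := bSorted_hyps n
  rw [hU, hW, hV]
  have hσ : ∀ s, s < 6 → 12 * n ≤ bn (bSorted n) (s + 2) := fun s hs => by
    rw [hj (s + 2) (by omega) (by omega)]; nlinarith
  have h2 : ∀ s, s < 6 → 2 * bn (bSorted n) (s + 2) ≤ bn (bSorted n) 0 := fun s hs => by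
    rw [hj (s + 2) (by omega) (by omega), h0]; nlinarith
  have h1 : bn (bSorted n) 1 ≤ 12 * n := by rw [hj 1 le_rfl (by norm_num)]; omega
  have hsort : ∀ s, s < 5 → bn (bSorted n) (s + 2) ≤ bn (bSorted n) (s + 3) := fun s hs => by
    rw [hj (s + 2) (by omega) (by omega), hj (s + 3) (by omega) (by omega)]; nlinarith
  have hw : wtop (bSorted n) (12 * n) = 17 * n := by unfold wtop; rw [h0]; omega
  refine ⟨?_, ?_, ?_⟩
  · exact coeffU_den19 hb hsum hσ h2 h1 _ (fun k hk1 hk2 => natCast_dvd_lcmUpto hk1 (by rw [hw] at hk2; exact hk2))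
  · exact coeffW_den19 hb hsum hσ h2 h1 _ (fun k hk1 hk2 => natCast_dvd_lcmUpto hk1 (by rw [hw] at hk2; exact hk2))
  · -- the six moduli: `d₁ = D_{18n}`, `d₂ = ⋯ = d₆ = D_{17n}`
    set d : ℕ → ℕ := fun i => if i = 1 then Nat.lcmUpto (18 * n) else Nat.lcmUpto (17 * n) with hd
    have hprod : ∏ i ∈ Icc 1 6, (d i : ℚ) =
        ((Nat.lcmUpto (18 * n) : ℕ) : ℚ) * ((Nat.lcmUpto (17 * n) : ℕ) : ℚ) ^ 5 := by
      have e1 : d 1 = Nat.lcmUpto (18 * n) := by simp [hd]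
      have e2 : ∀ i, i ≠ 1 → d i = Nat.lcmUpto (17 * n) := fun i hi => by simp [hd, hi]
      rw [show Icc 1 6 = ({1, 2, 3, 4, 5, 6} : Finset ℕ) by decide, prod_insert (by decide),
        prod_insert (by decide), prod_insert (by decide), prod_insert (by decide), prod_insert (by decide),
        prod_singleton, e1, e2 2 (by norm_num), e2 3 (by norm_num), e2 4 (by norm_num), e2 5 (by norm_num),
        e2 6 (by norm_num)]
      ring
    rw [← hprod]
    refine coeffV_den19_sorted hb hsum hσ h2 h1 hsort d (fun i hi k hk1 hk2 => ?_) (fun i hi k hk1 hk2 => ?_)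
    · rw [hw] at hk2
      rw [hd]; dsimp only
      split_ifs
      · exact natCast_dvd_lcmUpto hk1 (by omega)
      · exact natCast_dvd_lcmUpto hk1 hk2
    · have hi' := mem_Icc.1 hi
      rw [h0, hj 1 le_rfl (by norm_num), hj (i + 1) (by omega) (by omega)] at hk2
      rw [hd]; dsimp only
      split_ifs with hi1
      · subst hi1; exact natCast_dvd_lcmUpto hk1 (by omega)
      · refine natCast_dvd_lcmUpto hk1 ?_
        have hi2 : 2 ≤ i := by omega
        have hX : 13 * n ≤ (10 + (i + 1)) * n := by nlinarith
        generalize (10 + (i + 1)) * n = X at hk2 hX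
        omega

end DualSeriesLemma19

end Summit.KontsevichZagierPeriods.Zeta5Search
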